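import Literature.Geometry.Lorentzian.BogovskiiLemma23
import Literature.Geometry.Lorentzian.BogovskiiSmoothOutput
import Mathlib.Analysis.Convex.Join
import Mathlib.Analysis.Calculus.BumpFunction.FiniteDimension
import Mathlib.Analysis.Calculus.BumpFunction.Normed
import HarnessLib

/-!
# The classical Bogovskiĭ formula `div SV_η g = (∫η) g − (∫g) η` and smooth solutions of `div w = h` on star-shaped cells

(trunk G08 = T-LORENTZ; family `gr`; namespace `Literature.Geometry.Lorentzian.MaoOhTao`.)

The vector operator `(SV_η g)^a(x) = ∫ w_y(|x − y|, (x − y)/|x − y|) (x − y)_a/|x − y|³ g(y) dy` of Mao–Oh–Tao's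
Lemma 2.3 (arXiv:2308.13031; `bogovskiiSV`) is, in the classical form of the kernel (`BogovskiiClassicalForm.lean`),
Bogovskiĭ's operator for the divergence equation (Bogovskiĭ 1979; Galdi, *An introduction to the mathematical theory of
the Navier–Stokes equations*, III.3): `div (SV_η g) = (∫ η) g − (∫ g) η`.  The tree has this identity per base point `y`
in weak form (`sum_integral_bogovskiiV_pd_eq`: `div_z V(z; y) = (∫η) δ₀ − η(z + y)`); this file integrates the density
in and removes the test function:

* `sum_integral_bogovskiiSV_mul_pd_eq` — weak form at the operator level:
  `Σ_a ∫ (SV_η g)^a ∂ₐψ = −(∫η) ∫ g ψ + (∫ g) ∫ η ψ` (`η ∈ C_c`, `g ∈ C_c`, `ψ ∈ C¹_c`);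
* `sum_pd_bogovskiiSV_eq` — **pointwise**: `Σ_a ∂ₐ (SV_η g)^a (x) = (∫ η) g(x) − (∫ g) η(x)` for `η, g ∈ C¹_c`;
* the union of the segments `⋃_{y ∈ T} convexJoin B {y}` from a convex set `B` to a set `T`: star-shaped with respect to
  every point of `B`, compact for compact `B, T`, inside every `Ω ⊇ T` star-shaped with respect to `B` (the set carrying
  `SV_η g` when `supp η ⊆ B`, `supp g ⊆ T`; `starConvex_/isCompact_/…iUnion_convexJoin_singleton…`);
* `exists_smooth_divInverse_of_starConvex` — **Galdi's Lemma III.3.1 with smooth data**: on an open set star-shaped with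
  respect to every point of a ball, every `h ∈ C_c^∞` with `tsupp h ⊆ Ω`, `∫ h = 0` is `Σ_a ∂ₐ w^a` for a smooth field `w`
  compactly supported inside `Ω` (`w = SV_ζ h` with the normalised bump `ζ` of the ball; smoothness by
  `contDiff_infty_bogovskiiVOperator`); `exists_smooth_divInverse_of_convex` — the case of convex open sets (balls).

Everything is proved; no definitions, no named facts.  The gluing of such cells (finite chains of cells, spherical shells)
is `BogovskiiScalarGluing.lean`.

## References

* G. P. Galdi, *An Introduction to the Mathematical Theory of the Navier–Stokes Equations. Steady-State Problems*,
  2nd ed., Springer (2011), Lemma III.3.1 and Theorem III.3.1 (key `Galdi2011`).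
* Y. Mao, S.-J. Oh, T. Tao, arXiv:2308.13031 (2023), Lemma 2.3, p. 8 (key `MaoOhTao2023`).
* M. E. Bogovskiĭ, Dokl. Akad. Nauk SSSR 248 (1979), 1037–1040.
-/

noncomputable section

open scoped RealInnerProductSpace Topology ContDiff
open Filter MeasureTheory Set Metric Function

namespace Literature.Geometry.Lorentzian

namespace MaoOhTao

/-! ### The divergence of `SV_η g`: weak form at the operator level -/

section Weak

variable {η : E3 → ℝ} {R : ℝ}

/-- **`div SV_η g = (∫η) g − (∫g) η` in weak form**: for `η ∈ C_c` (vanishing off `B̄_R`), `g ∈ C_c` and `ψ ∈ C¹_c`,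
`Σ_a ∫ (SV_η g)^a(x) ∂ₐψ(x) dx = −(∫ η) ∫ g ψ + (∫ g) ∫ η ψ` (Fubini, then `div_z V(z; y) = (∫η)δ₀ − η(z + y)` for the
translated test function). [cite: Galdi2011, Lemma III.3.1] -/
theorem sum_integral_bogovskiiSV_mul_pd_eq (hη : Continuous η) (hR : ∀ z : E3, R < ‖z‖ → η z = 0) {g : E3 → ℝ}
    (hg : Continuous g) (hgc : HasCompactSupport g) {ψ : E3 → ℝ} (hψ : ContDiff ℝ 1 ψ) (hψc : HasCompactSupport ψ) :
    ∑ a, ∫ x : E3, bogovskiiSV η g a x * pd a ψ x =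
      -((∫ z : E3, η z) * ∫ y : E3, g y * ψ y) + (∫ y : E3, g y) * ∫ z : E3, η z * ψ z := by
  have hpc : ∀ a, Continuous (pd a ψ) := fun a ↦ (hψ.continuous_fderiv one_ne_zero).clm_apply continuous_const
  have hpcc : ∀ a, HasCompactSupport (pd a ψ) := fun a ↦ hasCompactSupport_pd hψc a
  -- Fubini, component by component
  have hF := fun a ↦ integral_bogovskiiV_operator_mul_eq hη hR hg hgc (hpc a) (hpcc a) a
  have hstep : ∀ a, ∫ x : E3, bogovskiiSV η g a x * pd a ψ x =
      ∫ y : E3, g y * ∫ z : E3, bogovskiiWeight η y ‖z‖ (‖z‖⁻¹ • z) * (z a * (‖z‖ ^ 3)⁻¹) * pd a ψ (z + y) := by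
    intro a
    simpa only [bogovskiiSV] using (hF a).2
  rw [Finset.sum_congr rfl fun a _ ↦ hstep a, ← integral_finsetSum _ fun a _ ↦ (hF a).1]
  -- the per-`y` divergence identity for the translated test function
  have hdiv : ∀ y : E3, ∑ a, ∫ z : E3, bogovskiiWeight η y ‖z‖ (‖z‖⁻¹ • z) * (z a * (‖z‖ ^ 3)⁻¹) * pd a ψ (z + y) =
      -(ψ y * ∫ z : E3, η z) + ∫ z : E3, η z * ψ z := by
    intro y
    have hφd : ContDiff ℝ 1 fun z : E3 ↦ ψ (z + y) := hψ.comp (contDiff_id.add contDiff_const)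
    have hφc : HasCompactSupport fun z : E3 ↦ ψ (z + y) := hψc.comp_homeomorph (Homeomorph.addRight y)
    have h := sum_integral_bogovskiiV_pd_eq hη hR hφd hφc y
    have h1 : ∀ a, (pd a fun z : E3 ↦ ψ (z + y)) = fun z ↦ pd a ψ (z + y) :=
      fun a ↦ funext fun z ↦ pd_comp_add_const ψ y z a
    simp only [h1, zero_add] at h
    rw [h, integral_add_right_eq_self (μ := (volume : Measure E3)) (fun z ↦ η z * ψ z) y]
  have hpt : ∀ y : E3, g y * ∑ a, ∫ z : E3, bogovskiiWeight η y ‖z‖ (‖z‖⁻¹ • z) * (z a * (‖z‖ ^ 3)⁻¹) *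
      pd a ψ (z + y) = -((∫ z : E3, η z) * (g y * ψ y)) + g y * ∫ z : E3, η z * ψ z := by
    intro y
    rw [hdiv y]
    ring
  have I1 : Integrable fun y : E3 ↦ g y * ψ y := (hg.mul hψ.continuous).integrable_of_hasCompactSupport hgc.mul_right
  have I2 : Integrable fun y : E3 ↦ g y * ∫ z : E3, η z * ψ z := (hg.integrable_of_hasCompactSupport hgc).mul_const _
  calc ∫ y : E3, ∑ a, g y * ∫ z : E3, bogovskiiWeight η y ‖z‖ (‖z‖⁻¹ • z) * (z a * (‖z‖ ^ 3)⁻¹) * pd a ψ (z + y)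
      = ∫ y : E3, (-((∫ z : E3, η z) * (g y * ψ y)) + g y * ∫ z : E3, η z * ψ z) := by
        refine integral_congr_ae (ae_of_all _ fun y ↦ ?_)
        simp only
        rw [← Finset.mul_sum, hpt y]
    _ = -((∫ z : E3, η z) * ∫ y : E3, g y * ψ y) + (∫ y : E3, g y) * ∫ z : E3, η z * ψ z := by
        have I3 : Integrable fun y : E3 ↦ -((∫ z : E3, η z) * (g y * ψ y)) := (I1.const_mul _).neg
        rw [integral_add I3 I2, integral_neg, integral_const_mul, integral_mul_const]

end Weak

/-! ### The divergence of `SV_η g`: pointwise -/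

section Pointwise

variable {η : E3 → ℝ} {R : ℝ}

/-- **Bogovskiĭ's formula, pointwise**: for `η ∈ C¹` vanishing off `B̄_R` and `g ∈ C¹_c`,
`Σ_a ∂ₐ (SV_η g)^a (x) = (∫ η) g(x) − (∫ g) η(x)` for every `x` (so `div SV_η g = g` when `∫ η = 1`, `∫ g = 0`).
[cite: Galdi2011, Lemma III.3.1] -/
theorem sum_pd_bogovskiiSV_eq (hη : ContDiff ℝ 1 η) (hR : ∀ z : E3, R < ‖z‖ → η z = 0) {g : E3 → ℝ}
    (hg : ContDiff ℝ 1 g) (hgc : HasCompactSupport g) (x : E3) :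
    ∑ a, pd a (bogovskiiSV η g a) x = (∫ z : E3, η z) * g x - (∫ y : E3, g y) * η x := by
  have hSV1 : ∀ a, ContDiff ℝ 1 (bogovskiiSV η g a) := fun a ↦ contDiff_one_bogovskiiSV hη hR hg hgc a
  set G : E3 → ℝ := fun x ↦ ∑ a, pd a (bogovskiiSV η g a) x with hG
  set H : E3 → ℝ := fun x ↦ (∫ z : E3, η z) * g x - (∫ y : E3, g y) * η x with hH
  have hGc : Continuous G := continuous_finsetSum _ fun a _ ↦ (contDiff_pd (n := 0) (hSV1 a) a).continuous
  have hHc : Continuous H := (continuous_const.mul hg.continuous).sub (continuous_const.mul hη.continuous)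
  have key : ∀ ψ : E3 → ℝ, ContDiff ℝ ∞ ψ → HasCompactSupport ψ → ∫ x, ψ x • G x = ∫ x, ψ x • H x := by
    intro ψ hψ hψc
    have hψ1 : ContDiff ℝ 1 ψ := hψ.of_le (by norm_cast)
    have hI : ∀ u : E3 → ℝ, Continuous u → Integrable fun x ↦ ψ x * u x := fun u hu ↦
      (hψ.continuous.mul hu).integrable_of_hasCompactSupport hψc.mul_right
    -- integration by parts in each component
    have IBP : ∀ a, ∫ x, ψ x * pd a (bogovskiiSV η g a) x = -∫ x, bogovskiiSV η g a x * pd a ψ x := by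
      intro a
      have h := integral_pd_mul_eq_neg hψ1 hψc (hSV1 a) a
      rw [integral_congr_ae (ae_of_all _ fun x ↦ mul_comm (bogovskiiSV η g a x) (pd a ψ x)), h, neg_neg]
    have hGint : ∫ x, ψ x * G x = -∑ a, ∫ x, bogovskiiSV η g a x * pd a ψ x := by
      simp only [hG, Finset.mul_sum]
      rw [integral_finsetSum _ fun a _ ↦ hI _ (contDiff_pd (n := 0) (hSV1 a) a).continuous]
      simp only [IBP, Finset.sum_neg_distrib]
    have hHint : ∫ x, ψ x * H x = (∫ z : E3, η z) * (∫ x, ψ x * g x) - (∫ y : E3, g y) * ∫ x, ψ x * η x := by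
      simp only [hH]
      have e : ∀ x, ψ x * ((∫ z : E3, η z) * g x - (∫ y : E3, g y) * η x) =
          (∫ z : E3, η z) * (ψ x * g x) - (∫ y : E3, g y) * (ψ x * η x) := fun x ↦ by ring
      simp only [e]
      rw [integral_sub ((hI g hg.continuous).const_mul _) ((hI η hη.continuous).const_mul _), integral_const_mul,
        integral_const_mul]
    simp only [smul_eq_mul]
    rw [hGint, hHint, sum_integral_bogovskiiSV_mul_pd_eq hη.continuous hR hg.continuous hgc hψ1 hψc,
      integral_congr_ae (ae_of_all _ fun y ↦ mul_comm (g y) (ψ y)),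
      integral_congr_ae (ae_of_all _ fun z ↦ mul_comm (η z) (ψ z))]
    ring
  have hae : ∀ᵐ x ∂(volume : Measure E3), G x = H x :=
    ae_eq_of_integral_contDiff_smul_eq hGc.locallyIntegrable hHc.locallyIntegrable key
  exact congrFun ((hGc.ae_eq_iff_eq volume hHc).1 hae) x

/-- In particular `div SV_η g = g` pointwise when `∫ η = 1` and `∫ g = 0`. [cite: Galdi2011, Lemma III.3.1] -/
theorem sum_pd_bogovskiiSV_eq_self (hη : ContDiff ℝ 1 η) (hR : ∀ z : E3, R < ‖z‖ → η z = 0)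
    (hη1 : ∫ z : E3, η z = 1) {g : E3 → ℝ} (hg : ContDiff ℝ 1 g) (hgc : HasCompactSupport g)
    (hg0 : ∫ y : E3, g y = 0) (x : E3) : ∑ a, pd a (bogovskiiSV η g a) x = g x := by
  rw [sum_pd_bogovskiiSV_eq hη hR hg hgc x, hη1, hg0, one_mul, zero_mul, sub_zero]

end Pointwise

/-! ### The union of the segments from a convex set -/

section SegmentJoin

/-- Membership in **the union of the segments from `B` to `T`**, `⋃_{y ∈ T} convexJoin B {y} = ⋃_{b ∈ B, y ∈ T} [b, y]`:
`p` lies in it iff `p ∈ [b, y]` for some `b ∈ B`, `y ∈ T`. [folklore] -/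
theorem mem_iUnion_convexJoin_singleton {B T : Set E3} {p : E3} :
    p ∈ (⋃ y ∈ T, convexJoin ℝ B {y}) ↔ ∃ y ∈ T, ∃ b ∈ B, p ∈ segment ℝ b y := by
  simp only [mem_iUnion, exists_prop, mem_convexJoin, mem_singleton_iff]
  constructor
  · rintro ⟨y, hy, b, hb, y', rfl, hp⟩
    exact ⟨y', hy, b, hb, hp⟩
  · rintro ⟨y, hy, b, hb, hp⟩
    exact ⟨y, hy, b, hb, y, rfl, hp⟩

/-- The union of the segments from a convex set `B` is star-shaped with respect to every point of `B`. [folklore] -/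
theorem starConvex_iUnion_convexJoin_singleton {B : Set E3} (hB : Convex ℝ B) (T : Set E3) {b : E3} (hb : b ∈ B) :
    StarConvex ℝ b (⋃ y ∈ T, convexJoin ℝ B {y}) :=
  starConvex_iUnion fun y ↦ starConvex_iUnion fun _ ↦
    (hB.convexJoin (convex_singleton y)).starConvex (subset_convexJoin_left (singleton_nonempty y) hb)

/-- `T` lies in the union of the segments from a nonempty `B` to `T`. [folklore] -/
theorem subset_iUnion_convexJoin_singleton {B : Set E3} (hB : B.Nonempty) (T : Set E3) :
    T ⊆ ⋃ y ∈ T, convexJoin ℝ B {y} :=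
  fun y hy ↦ mem_iUnion₂.2 ⟨y, hy, subset_convexJoin_right hB (mem_singleton y)⟩

/-- The union of the segments from `B` to `T` lies in every `Ω ⊇ T` star-shaped with respect to every point of `B`.
[folklore] -/
theorem iUnion_convexJoin_singleton_subset {B T Ω : Set E3} (hΩ : ∀ b ∈ B, StarConvex ℝ b Ω) (hT : T ⊆ Ω) :
    (⋃ y ∈ T, convexJoin ℝ B {y}) ⊆ Ω := by
  intro p hp
  obtain ⟨y, hy, b, hb, hp⟩ := mem_iUnion_convexJoin_singleton.1 hp
  exact (hΩ b hb).segment_subset (hT hy) hp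

/-- The union of the segments from `B` to `T` as a continuous image of `B × T × [0, 1]`. [folklore] -/
theorem iUnion_convexJoin_singleton_eq_image (B T : Set E3) :
    (⋃ y ∈ T, convexJoin ℝ B {y}) =
      (fun p : E3 × E3 × ℝ ↦ p.1 + p.2.2 • (p.2.1 - p.1)) '' (B ×ˢ T ×ˢ Icc (0 : ℝ) 1) := by
  ext q
  rw [mem_iUnion_convexJoin_singleton, mem_image]
  constructor
  · rintro ⟨y, hy, b, hb, hq⟩
    rw [segment_eq_image'] at hq
    obtain ⟨θ, hθ, rfl⟩ := hq
    exact ⟨(b, y, θ), ⟨hb, hy, hθ⟩, rfl⟩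
  · rintro ⟨⟨b, y, θ⟩, ⟨hb, hy, hθ⟩, rfl⟩
    refine ⟨y, hy, b, hb, ?_⟩
    rw [segment_eq_image']
    exact ⟨θ, hθ, rfl⟩

/-- The union of the segments between two compact sets is compact. [folklore] -/
theorem isCompact_iUnion_convexJoin_singleton {B T : Set E3} (hB : IsCompact B) (hT : IsCompact T) :
    IsCompact (⋃ y ∈ T, convexJoin ℝ B {y}) := by
  rw [iUnion_convexJoin_singleton_eq_image]
  exact (hB.prod (hT.prod isCompact_Icc)).image (by fun_prop)

end SegmentJoin

/-! ### Smooth compactly supported solutions of `div w = h` on star-shaped cells -/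

section DivInverse

/-- **Star-shaped cells** (Galdi's Lemma III.3.1 with smooth data; Mao–Oh–Tao's Lemma 2.3 for the vector operator): if
`Ω` is star-shaped with respect to every point of an open ball `ball c r`, then every `h ∈ C_c^∞(ℝ³)` with `tsupp h ⊆ Ω`
and `∫ h = 0` is the divergence `Σ_a ∂ₐ w^a` of a smooth field `w` with compact support and `tsupp w^a ⊆ Ω` — namely
`w = SV_ζ h` with the normalised bump `ζ` of `ball c (r/2)`, carried by the union of the segments from `closedBall c (r/2)`
to `tsupp h`. [cite: Galdi2011, Lemma III.3.1] -/
theorem exists_smooth_divInverse_of_starConvex {Ω : Set E3} {c : E3} {r : ℝ} (hr : 0 < r)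
    (hΩ : ∀ b ∈ ball c r, StarConvex ℝ b Ω) (h : E3 → ℝ) (hh : ContDiff ℝ ∞ h) (hhc : HasCompactSupport h)
    (hhΩ : tsupport h ⊆ Ω) (hh0 : ∫ x, h x = 0) :
    ∃ w : Fin 3 → E3 → ℝ, (∀ a, ContDiff ℝ ∞ (w a)) ∧ (∀ a, HasCompactSupport (w a)) ∧
      (∀ a, tsupport (w a) ⊆ Ω) ∧ ∀ x, ∑ a, pd a (w a) x = h x := by
  -- the normalised bump `ζ` of `ball c (r/2)`
  let bmp : ContDiffBump c := ⟨r / 4, r / 2, by positivity, by linarith⟩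
  set ζ : E3 → ℝ := bmp.normed volume with hζdef
  have hζ : ContDiff ℝ ∞ ζ := bmp.contDiff_normed
  have hζ1 : ∫ z : E3, ζ z = 1 := bmp.integral_normed
  have hζB : ∀ z, ζ z ≠ 0 → z ∈ closedBall c (r / 2) := fun z hz ↦ by
    have : z ∈ support ζ := mem_support.2 hz
    rw [hζdef, bmp.support_normed_eq] at this
    exact ball_subset_closedBall this
  have hR : ∀ z : E3, ‖c‖ + r < ‖z‖ → ζ z = 0 := by
    intro z hz
    by_contra hne
    have hzB := hζB z hne
    rw [mem_closedBall, dist_eq_norm] at hzB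
    have : ‖z‖ ≤ ‖z - c‖ + ‖c‖ := norm_le_norm_sub_add z c
    linarith
  -- the compact set carrying the solution
  set K : Set E3 := ⋃ y ∈ tsupport h, convexJoin ℝ (closedBall c (r / 2)) {y} with hKdef
  have hKB : ∀ b ∈ closedBall c (r / 2), StarConvex ℝ b K := fun b hb ↦
    starConvex_iUnion_convexJoin_singleton (convex_closedBall c _) _ hb
  have hKc : IsCompact K := isCompact_iUnion_convexJoin_singleton (isCompact_closedBall c _) hhc
  have hKΩ : K ⊆ Ω :=
    iUnion_convexJoin_singleton_subset (fun b hb ↦ hΩ b (closedBall_subset_ball (by linarith) hb)) hhΩ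
  have hhK : ∀ y, h y ≠ 0 → y ∈ K := fun y hy ↦
    subset_iUnion_convexJoin_singleton ⟨c, mem_closedBall_self (by positivity)⟩ _
      (subset_tsupport h (mem_support.2 hy))
  have hsupp : ∀ a, support (bogovskiiSV ζ h a) ⊆ K := fun a ↦ support_bogovskiiSV_subset hKB hζB hhK a
  refine ⟨fun a ↦ bogovskiiSV ζ h a, fun a ↦ ?_, fun a ↦ ?_, fun a ↦ ?_, fun x ↦ ?_⟩
  · exact contDiff_infty_bogovskiiVOperator hζ hR hh hhc a
  · exact HasCompactSupport.intro hKc fun x hx ↦ notMem_support.1 fun hx' ↦ hx (hsupp a hx')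
  · exact (closure_minimal (hsupp a) hKc.isClosed).trans hKΩ
  · exact sum_pd_bogovskiiSV_eq_self (hζ.of_le (by norm_cast)) hR hζ1 (hh.of_le (by norm_cast)) hhc hh0 x

/-- **Nonempty convex open sets** (in particular balls): every `h ∈ C_c^∞` with `tsupp h ⊆ Ω` and `∫ h = 0` is the
divergence of a smooth field compactly supported in `Ω`. [cite: Galdi2011, Lemma III.3.1] -/
theorem exists_smooth_divInverse_of_convex {Ω : Set E3} (hΩo : IsOpen Ω) (hΩc : Convex ℝ Ω) (hΩn : Ω.Nonempty)
    (h : E3 → ℝ) (hh : ContDiff ℝ ∞ h) (hhc : HasCompactSupport h) (hhΩ : tsupport h ⊆ Ω) (hh0 : ∫ x, h x = 0) :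
    ∃ w : Fin 3 → E3 → ℝ, (∀ a, ContDiff ℝ ∞ (w a)) ∧ (∀ a, HasCompactSupport (w a)) ∧
      (∀ a, tsupport (w a) ⊆ Ω) ∧ ∀ x, ∑ a, pd a (w a) x = h x := by
  obtain ⟨c, hc⟩ := hΩn
  obtain ⟨r, hr, hball⟩ := Metric.isOpen_iff.1 hΩo c hc
  exact exists_smooth_divInverse_of_starConvex hr (fun b hb ↦ hΩc.starConvex (hball hb)) h hh hhc hhΩ hh0

end DivInverse

end MaoOhTao

end Literature.Geometry.Lorentzian

end
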